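import Literature.MathematicalPhysics.QuantumManyBody.LiebYngvasonLowerBoundAssembly
import Literature.MathematicalPhysics.QuantumManyBody.LiebYngvasonCellMethod
import Literature.MathematicalPhysics.QuantumManyBody.DyadicCoherentFraction

/-!
# Route `BECDyadicChaining`, crux `BaseCoherentMass` — helpers for the truncated no-clumping stub

Support lemmas for `stub_noClumpingInteracting` of the line `registered` of crux
stmt-AtomisticToContinuum-13193 (lead prover):

* `lyK_crude_parameters` — a CRUDE-constant parameter choice for the Lieb–Yngvason box bound
  (LSSY (2.54)–(2.56)) at the interparticle scale: with `ε = y`, `R = ℓy`, `py ≤ 8`, `y ≤ 1/400`,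
  `2R₀y⁵ ≤ a ≤ ℓy⁶`, the Temple denominator is positive, the Temple error is `≤ 1`, and
  `lyK a R₀ R ε ℓ p ≥ 1 - 16y ≥ 24/25` (the four factors of (2.56) are each `1 - O(y)`); unlike the
  thermodynamic choice (2.59)–(2.63) the particle number `p` is FIXED and the cell is huge.
* `sum_cellWeight_eq_one`, `sum_cellWeight_mul_sum_le_energy` — the cell method (2.52) STATE-WISE
  for a Dirichlet trial state `Ψ` of the box of side `L = 2^K ℓ`: the weights
  `w(σ) = ∫_{cellSet σ} |Ψ|²` of the particle-to-cell assignments `σ` sum to `1`, and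
  `Σ_σ w(σ) Σ_c E₀^Neu(n_c(σ), ℓ) ≤ energy v Ψ`.
* `sum_setLIntegral_mem_dyCell_eq` — the expected number of particles in a dyadic cell is the
  `w`-average of the occupation number: `Σ_j ∫_{x_j ∈ C} |Ψ|² = Σ_σ w(σ) n_C(σ)`.

References: [LSSY2005] Lieb–Seiringer–Solovej–Yngvason, *The Mathematics of the Bose Gas and its
Condensation* (2005), (2.44)–(2.56).
-/

noncomputable section

namespace Summit.AtomisticToContinuum.BoseEinsteinCondensation.Theorems.BaseCoherentMass

open MeasureTheory
open scoped ENNReal NNReal BigOperators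
open Literature.MathematicalPhysics.QuantumManyBody.BoseGas

/-! ### Crude parameters for the box bound -/

/-- **Crude-constant parameters for LSSY (2.54)–(2.56).** With `ε = y`, `R = ℓ y`, `p y ≤ 8`,
`y ≤ 1/400`, `2R₀y⁵ ≤ a ≤ ℓy⁶`: the Temple denominator at `p` is positive, the Temple error at `p`
is at most `1`, `R₀ < R`, `2R < ℓ`, `4πR³/(3ℓ³) ≤ 1`, and `1 - 16y ≤ lyK a R₀ R ε ℓ p`
(the factors `1-ε`, `(1-2R/ℓ)³ ≥ 1-6y`, `(1-4πR³/(3ℓ³))^{p-1} ≥ 1-y`, Temple `≥ 1-8y`).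
[cite: LSSY2005, (2.54)–(2.56) and (2.59)–(2.63)] -/
theorem lyK_crude_parameters : ∀ (a R₀ ℓ y : ℝ) (p : ℕ), 0 < a → 0 < y → y ≤ 1 / 400 →
    a / y ^ 6 ≤ ℓ → (p : ℝ) * y ≤ 8 → 0 ≤ R₀ → 2 * R₀ * y ^ 5 ≤ a →
    0 < Real.pi * y / ℓ ^ 2 - 4 * a * p * (p - 1) / ℓ ^ 3 ∧
    3 * a * p / (Real.pi * ((ℓ * y) ^ 3 - R₀ ^ 3) *
      (Real.pi * y / ℓ ^ 2 - 4 * a * p * (p - 1) / ℓ ^ 3)) ≤ 1 ∧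
    R₀ < ℓ * y ∧ 2 * (ℓ * y) < ℓ ∧ 4 * Real.pi * (ℓ * y) ^ 3 / (3 * ℓ ^ 3) ≤ 1 ∧
    1 - 16 * y ≤ lyK a R₀ (ℓ * y) y ℓ p := by
  intro a R₀ ℓ y p ha hy hy1 hℓ1 hp8 hR₀ hR₀a
  have hpi4 := Real.pi_lt_four
  have hy6 : 0 < y ^ 6 := by positivity
  have hℓ : 0 < ℓ := (div_pos ha hy6).trans_le hℓ1
  have haℓ : a ≤ ℓ * y ^ 6 := by rwa [div_le_iff₀ hy6] at hℓ1
  have hy64 : y ≤ 1 / 64 := hy1.trans (by norm_num)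
  have hε1 : y ≤ 1 := hy1.trans (by norm_num)
  have hy3 : 256 * y ^ 3 ≤ 1 := by
    have : y ^ 3 ≤ (1 / 64) ^ 3 := pow_le_pow_left₀ hy.le hy64 3
    norm_num at this
    linarith
  have hp0 : (0 : ℝ) ≤ p := Nat.cast_nonneg p
  have hD2 := lyK_temple_denominator_bound ha.le hy hy3 hℓ haℓ hp0 hp8
  obtain ⟨hR₀R, hΔ⟩ := lyK_shell_bound hy hℓ haℓ hR₀ hR₀a
  have hT8 := lyK_temple_error_bound ha.le hy hℓ haℓ hp8 hD2 hΔ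
  have hD : 0 < Real.pi * y / ℓ ^ 2 - 4 * a * p * (p - 1) / ℓ ^ 3 :=
    lt_of_lt_of_le (by positivity) hD2
  have hℓy : 0 < ℓ * y := mul_pos hℓ hy
  have hR₀ltR : R₀ < ℓ * y := hR₀R.trans_lt (by linarith)
  have h2R : 2 * (ℓ * y) < ℓ := by nlinarith
  have hq : 4 * Real.pi * (ℓ * y) ^ 3 / (3 * ℓ ^ 3) = 4 * Real.pi / 3 * y ^ 3 := by
    field_simp
  have hq1 : 4 * Real.pi * (ℓ * y) ^ 3 / (3 * ℓ ^ 3) ≤ 1 := by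
    rw [hq]
    have h3 : y ^ 3 ≤ 1 / 256 := by linarith
    have : 4 * Real.pi / 3 * y ^ 3 ≤ 4 * 4 / 3 * (1 / 256) :=
      mul_le_mul (by linarith) h3 (by positivity) (by positivity)
    linarith
  refine ⟨hD, hT8.trans (by linarith), hR₀ltR, h2R, hq1, ?_⟩
  -- the four factors
  have h2R' : 2 * (ℓ * y) / ℓ = 2 * y := by field_simp
  have hF2 : 1 - 6 * y ≤ (1 - 2 * (ℓ * y) / ℓ) ^ 3 := by
    rw [h2R']
    have : (1 - 2 * y) ^ 3 = 1 - 6 * y + y ^ 2 * (12 - 8 * y) := by ring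
    rw [this]
    have : 0 ≤ y ^ 2 * (12 - 8 * y) := mul_nonneg (sq_nonneg y) (by linarith)
    linarith
  have hF3 : 1 - y ≤ (1 - 4 * Real.pi * (ℓ * y) ^ 3 / (3 * ℓ ^ 3)) ^ (p - 1) := by
    rw [hq]; exact lyK_shell_probability_bound hy hy64 hp8
  have hF4 : 1 - 8 * y ≤ 1 - 3 * a * p / (Real.pi * ((ℓ * y) ^ 3 - R₀ ^ 3) *
      (Real.pi * y / ℓ ^ 2 - 4 * a * p * (p - 1) / ℓ ^ 3)) := by linarith
  unfold lyK
  obtain ⟨h12₀, h12⟩ := one_sub_add_le_mul (sub_nonneg.2 hε1) le_rfl hF2 hy.le (by positivity)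
    (by linarith)
  obtain ⟨h123₀, h123⟩ := one_sub_add_le_mul h12₀ h12 hF3 (by positivity) hy.le hε1
  obtain ⟨-, h1234⟩ := one_sub_add_le_mul h123₀ h123 hF4 (by positivity) (by positivity)
    (by linarith)
  linarith

/-! ### The cell method, state-wise, for a Dirichlet trial state -/

section Cells

variable {N K : ℕ} {L ℓ : ℝ}

/-- The big box is a.e. the union of the open cells of side `ℓ = L/2^K`. [cite: LSSY2005, (2.52)] -/
theorem boxN_ae_eq_iUnion_cellSet_pow (hℓ : 0 < ℓ) (hL : ((2 ^ K : ℕ) : ℝ) * ℓ = L) :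
    boxN N L =ᵐ[volume] ⋃ σ : Fin N → Fin ((2 ^ K) ^ 3), cellSet (2 ^ K) ℓ σ := by
  have h := boxN_ae_eq_iUnion_cellSet (N := N) hℓ (pow_pos (by norm_num : 0 < 2) K)
  rwa [hL] at h

/-- **The assignment weights are a probability.** For a Dirichlet trial state of the box of side
`L = 2^K ℓ`, `Σ_σ ∫_{cellSet σ} |Ψ|² = 1`. [cite: LSSY2005, (2.52)] -/
theorem sum_cellWeight_eq_one (hℓ : 0 < ℓ) (hL : ((2 ^ K : ℕ) : ℝ) * ℓ = L) (Ψ : TrialState N L) :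
    ∑ σ : Fin N → Fin ((2 ^ K) ^ 3), ∫⁻ X in cellSet (2 ^ K) ℓ σ, (‖Ψ.ψ X‖₊ : ℝ≥0∞) ^ 2 = 1 := by
  rw [← Ψ.toNeumann.norm_eq]
  change _ = ∫⁻ X in boxN N L, (‖Ψ.ψ X‖₊ : ℝ≥0∞) ^ 2
  rw [setLIntegral_congr (boxN_ae_eq_iUnion_cellSet_pow (N := N) hℓ hL),
    lintegral_iUnion (fun σ => measurableSet_cellSet (2 ^ K) ℓ σ) (pairwiseDisjoint_cellSet hℓ),
    tsum_fintype]

/-- **The cell method state-wise (LSSY (2.52) before taking the infimum).** For a Dirichlet trial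
state `Ψ` of the box of side `L = 2^K ℓ` and a measurable `v ≥ 0`:
`Σ_σ w(σ) · Σ_c E₀^Neu(n_c(σ), ℓ) ≤ energy v Ψ`, `w(σ) = ∫_{cellSet σ}|Ψ|²`, `n_c(σ)` the number of
particles the assignment `σ` puts into cell `c` (Neumann conditions on each cell only lower the
energy and the cross-cell interactions are non-negative). [cite: LSSY2005, (2.52)] -/
theorem sum_cellWeight_mul_sum_le_energy {v : ℝ → ℝ≥0∞} (hv : Measurable v) (hℓ : 0 < ℓ)
    (Ψ : TrialState N L) :
    ∑ σ : Fin N → Fin ((2 ^ K) ^ 3), (∫⁻ X in cellSet (2 ^ K) ℓ σ, (‖Ψ.ψ X‖₊ : ℝ≥0∞) ^ 2) *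
        ∑ c : Fin ((2 ^ K) ^ 3),
          neumannGroundStateEnergy v (Finset.univ.filter fun i => σ i = c).card ℓ ≤
      energy v Ψ := by
  calc ∑ σ : Fin N → Fin ((2 ^ K) ^ 3), (∫⁻ X in cellSet (2 ^ K) ℓ σ, (‖Ψ.ψ X‖₊ : ℝ≥0∞) ^ 2) *
        ∑ c : Fin ((2 ^ K) ^ 3), neumannGroundStateEnergy v (Finset.univ.filter fun i => σ i = c).card ℓ
      ≤ ∑ σ : Fin N → Fin ((2 ^ K) ^ 3), ∫⁻ X in cellSet (2 ^ K) ℓ σ,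
          kineticDensity Ψ.ψ X + interaction v X * (‖Ψ.ψ X‖₊ : ℝ≥0∞) ^ 2 := by
        refine Finset.sum_le_sum fun σ _ => ?_
        rw [mul_comm]
        exact sum_neumannGroundStateEnergy_mul_le_setLIntegral_cellSet hv Ψ.contDiff σ
    _ = ∫⁻ X in ⋃ σ : Fin N → Fin ((2 ^ K) ^ 3), cellSet (2 ^ K) ℓ σ,
          kineticDensity Ψ.ψ X + interaction v X * (‖Ψ.ψ X‖₊ : ℝ≥0∞) ^ 2 := by
        rw [lintegral_iUnion (fun σ => measurableSet_cellSet (2 ^ K) ℓ σ) (pairwiseDisjoint_cellSet hℓ),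
          tsum_fintype]
    _ ≤ energy v Ψ := setLIntegral_le_lintegral _ _

/-- The open cell of an assignment lies in the half-open dyadic cell with the same lattice
coordinates (side `ℓ = L/2^K`). [folklore] -/
theorem mem_dyCell_of_mem_cellSet (hℓ : ℓ = L / 2 ^ K) {σ : Fin N → Fin ((2 ^ K) ^ 3)} {X : Config N}
    (hX : X ∈ cellSet (2 ^ K) ℓ σ) (j : Fin N) :
    X j ∈ dyCell L K (cellCoord (2 ^ K) (σ j)) := by
  rw [mem_dyCell_iff]
  intro k
  have h := hX j k
  simp only [PiLp.sub_apply, cellCorner_apply, Set.mem_Ioo] at h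
  rw [← hℓ]
  constructor <;> nlinarith [h.1, h.2]

/-- If a configuration of `cellSet σ` has particle `j` in the dyadic cell with coordinates `i`,
then `σ j` is the cell with coordinates `i`. [folklore] -/
theorem apply_eq_of_mem_cellSet_of_mem_dyCell (hℓ : ℓ = L / 2 ^ K)
    {σ : Fin N → Fin ((2 ^ K) ^ 3)} {X : Config N} (hX : X ∈ cellSet (2 ^ K) ℓ σ) {j : Fin N}
    {i : Fin 3 → Fin (2 ^ K)} (hj : X j ∈ dyCell L K i) : σ j = finFunctionFinEquiv i := by
  have h1 := mem_dyCell_of_mem_cellSet hℓ hX j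
  by_contra hne
  have hne' : cellCoord (2 ^ K) (σ j) ≠ i := by
    intro h
    apply hne
    have : finFunctionFinEquiv (cellCoord (2 ^ K) (σ j)) = finFunctionFinEquiv i := by rw [h]
    simpa [cellCoord] using this
  exact Set.disjoint_left.mp (disjoint_dyCell hne') h1 hj

/-- **Expected cell number as an average over assignments.** For a Dirichlet trial state of the box
of side `L` and a dyadic cell `C` of level `K` (side `ℓ = L/2^K`):
`Σ_j ∫_{x_j ∈ C} |Ψ|² = Σ_σ (∫_{cellSet σ}|Ψ|²) · n_C(σ)`, where `n_C(σ)` is the number of particles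
that `σ` assigns to `C` (the cells partition the box up to a null set and `Ψ` vanishes off the box).
[cite: LSSY2005, (2.52)] -/
theorem sum_setLIntegral_mem_dyCell_eq (hL0 : 0 < L) (Ψ : TrialState N L) (K : ℕ)
    (i : Fin 3 → Fin (2 ^ K)) :
    ∑ j : Fin N, ∫⁻ X in {X : Config N | X j ∈ dyCell L K i}, (‖Ψ.ψ X‖₊ : ℝ≥0∞) ^ 2 =
      ∑ σ : Fin N → Fin ((2 ^ K) ^ 3), (∫⁻ X in cellSet (2 ^ K) (L / 2 ^ K) σ, (‖Ψ.ψ X‖₊ : ℝ≥0∞) ^ 2) *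
        ((Finset.univ.filter fun j => σ j = finFunctionFinEquiv i).card : ℝ≥0∞) := by
  classical
  set ℓ : ℝ := L / 2 ^ K with hℓ
  have hℓ0 : 0 < ℓ := by positivity
  have hLℓ : ((2 ^ K : ℕ) : ℝ) * ℓ = L := by
    rw [hℓ]; push_cast; field_simp
  set c : Fin ((2 ^ K) ^ 3) := finFunctionFinEquiv i with hc
  set F : Config N → ℝ≥0∞ := fun X => (‖Ψ.ψ X‖₊ : ℝ≥0∞) ^ 2 with hF
  have hFm : Measurable F := (Ψ.contDiff.continuous.measurable.nnnorm.coe_nnreal_ennreal).pow_const 2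
  set U : Set (Config N) := ⋃ σ : Fin N → Fin ((2 ^ K) ^ 3), cellSet (2 ^ K) ℓ σ with hU
  have hbox : boxN N L =ᵐ[volume] U := boxN_ae_eq_iUnion_cellSet_pow (N := N) hℓ0 hLℓ
  -- `F` vanishes off the box
  have hFind : F = (boxN N L).indicator F := by
    funext X
    by_cases hX : X ∈ boxN N L
    · rw [Set.indicator_of_mem hX]
    · rw [Set.indicator_of_notMem hX, hF]
      simp [Ψ.eq_zero X hX]
  have hAm : ∀ j : Fin N, MeasurableSet {X : Config N | X j ∈ dyCell L K i} := fun j =>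
    (measurableSet_dyCell L K i).preimage (measurable_pi_apply j)
  -- each particle's term as a sum over the assignments
  have hj : ∀ j : Fin N, ∫⁻ X in {X : Config N | X j ∈ dyCell L K i}, F X =
      ∑ σ : Fin N → Fin ((2 ^ K) ^ 3),
        if σ j = c then ∫⁻ X in cellSet (2 ^ K) ℓ σ, F X else 0 := by
    intro j
    set A : Set (Config N) := {X : Config N | X j ∈ dyCell L K i} with hA
    have h1 : ∫⁻ X in A, F X = ∫⁻ X in A ∩ U, F X := by
      calc ∫⁻ X in A, F X = ∫⁻ X in A, (boxN N L).indicator F X := by rw [← hFind]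
        _ = ∫⁻ X in boxN N L ∩ A, F X := setLIntegral_indicator (measurableSet_boxN N L) F
        _ = ∫⁻ X in A ∩ boxN N L, F X := by rw [Set.inter_comm]
        _ = ∫⁻ X in A ∩ U, F X := setLIntegral_congr ((ae_eq_refl A).inter hbox)
    have h2 : A ∩ U = ⋃ σ ∈ (Finset.univ.filter fun σ : Fin N → Fin ((2 ^ K) ^ 3) => σ j = c),
        cellSet (2 ^ K) ℓ σ := by
      ext X
      simp only [hU, Set.mem_inter_iff, Set.mem_iUnion, Finset.mem_filter, Finset.mem_univ,
        true_and, exists_prop]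
      constructor
      · rintro ⟨hXA, σ, hXσ⟩
        exact ⟨σ, apply_eq_of_mem_cellSet_of_mem_dyCell hℓ hXσ hXA, hXσ⟩
      · rintro ⟨σ, hσ, hXσ⟩
        refine ⟨?_, σ, hXσ⟩
        have h3 := mem_dyCell_of_mem_cellSet (N := N) hℓ hXσ j
        rw [hσ] at h3
        have h4 : X j ∈ dyCell L K i := by simpa [hc, cellCoord] using h3
        exact h4
    rw [h1, h2, lintegral_biUnion_finset (fun σ _ σ' _ hne => pairwiseDisjoint_cellSet hℓ0 hne)
      (fun σ _ => measurableSet_cellSet (2 ^ K) ℓ σ), Finset.sum_filter]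
  simp only [hj]
  rw [Finset.sum_comm]
  refine Finset.sum_congr rfl fun σ _ => ?_
  rw [← Finset.sum_filter, Finset.sum_const, nsmul_eq_mul, mul_comm]

end Cells

end Summit.AtomisticToContinuum.BoseEinsteinCondensation.Theorems.BaseCoherentMass

end
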